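import Summits.BirchSwinnertonDyer.BirchSwinnertonDyer.Theorems.PrintCFramBottomClassIndexLawFiveLeFlipRungTwoEightThetaSeries
import HarnessLib

set_option autoImplicit false

/-!
# Crux `PrintCFram.BottomClassIndexLawFiveLe` (stmt-BirchSwinnertonDyer-20372), line `eisenstein-resource-bdp-line` (registry v29 `stub_flipRungs.2`,
# the `8 ∣ m` half = w6 g10's (JMLTwoEight⁶)): THE 2-ADIC FLIPPED-CUSP RUNG FOR `e = 3`, piece P6f —
# THE BRACKET `B₁₆` AT `W₁₆ = γ₀·diag(256,1)` AND THE NF-Q TRANSPORT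
# (cell `bsd-print-cfram`, width seat `bsd-line-cfram-p1-w4` g20; THEOREMS ONLY, `--supports` 20372 `--as helper`; BSD is not proved by any of this)

HONEST FRAMING. Analysis of the bracket `B₁₆(z) := 16^{−(k+1)}·P(γ₀•z)·(√((Mz+256)/16)^{2k+1})⁻¹` of the factorisation
`V ∣_{k+1} γ₀ = Θ₁₆·B₁₆` of the `e = 3` vehicle `V = P·θ(16·)` (`P` the modulus-`16` class cut of `g`, a half-integral weight form of level
`N_P ∣ 1024M`; `γ₀ = [a b; M 256] ∈ SL₂(ℤ)`, `M` the odd level; at `z = 256•w` the base `(Mz+256)/16` is P6a/P6c's `16(Mw+1)`), and the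
APPLICATION of w3 g19's transport `exists_isIntegral_qExpansion_coeff_of_slash_eq_mul`. This is the `R = 16` twin of w5 g8's P4d
(`…FlipRungTwoBracket`, `γ₀ = [a b; M 64]`, base `(Mz+64)/8`, period `256`); nothing here is a statement about elliptic curves, Bernoulli
numbers or BSD; no registered stub is closed; NF-Q (Katz 1973 Cor. 1.6.2) enters as a HYPOTHESIS exactly as in T4/T8/P4d.
* §1 THE CONJUGATION `γ₀·T¹⁰²⁴ = N·γ₀`, `N = [1 − 1024aM, 1024a²; −1024M², 1 + 1024aM] = [1 − 8M″u, u²; −64M″², 1 + 8M″u]` with `M″ = 4M`,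
  `u = 32a` — so P6d's multiplier lemmas apply VERBATIM (`thetaEps_one_add_eight_mul`, `shimuraSymbol_neg_sq_one_add_eight_mul`): for
  `P ∈ halfIntModularForms κ N_P ψ`, `4 ∣ N_P`, `N_P ∣ 1024M`: `P(γ₀•(z+1024))·(√Y^κ)⁻¹ = P(γ₀•z)·(√X^κ)⁻¹` for every admissible base
  pair, hence **`bracketSixteen_periodic`**: `B₁₆(z + 1024) = B₁₆(z)`.
* §2 `B₁₆` is holomorphic and bounded at `i∞` (`‖B₁₆‖² = 16⁻¹·‖slashSq (2k+1) P γ₀‖`, the cusp condition of `P`; `√((Mz+256)/16) = j(·;M,256)/4`)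
  ⟹ `AnalyticAt (cuspFunction N B₁₆) 0` and Mathlib's `hasSum_qExpansion` for `1024 ∣ N`.
* §3 **`exists_isIntegral_bracketSixteen_coeff_of_factorisation`** — THE TRANSPORT through ANY factorisation `f ∣ γ₀ = Θ·B₁₆` with the
  three `Θ`-hypotheses (analytic cusp function, coefficients in `ℤ̄[1/N]`, unit constant term); and **`exists_isIntegral_bracketSixteen_coeff`**
  — NF-Q + `f : ModularForm (Gamma1 L) (k+1)` with `⇑f = P·θ(16·)` and every coefficient of `qExpansion 1 f` in `p·ℤ̄[1/N]` ⟹ EVERY coefficient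
  of `qExpansion N B₁₆` lies in `p·ℤ̄[1/N]` (w8 g10's P6e `slash_flippedCusp_eq_thetaSixteen_mul_bracket` + `thetaSixteen_transport_hypotheses`
  + §2), for `1024 ∣ N`, `M ∣ N`. What P6h still has to do: identify `qExpansion N B₁₆` with `16^{−(k+1)}(ODD₁₆ + JUNK₁₆)` via P6c's `HasSum`
  and P6d's quarter-periodic junk, and read the unit weights (P6b).
beyond-print theorem: NO.

References: [Shimura1973HalfIntegral] §1; [Katz1973] §1.6 Cor. 1.6.2 (NF-Q, hypothesis); [DiamondShurman2005] §1.1–1.2; w5 g8's P4d;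
w8 g10's road (HOME/STATUS 2026-08-29T11:14:53Z, P6a–P6d).
-/

-- summit-side namespace `Summit.BirchSwinnertonDyer.BirchSwinnertonDyer.…` (single-conjunct summit, D-0017 layout)
set_option linter.dupNamespace false

noncomputable section

open scoped MatrixGroups ModularForm Real Classical Topology Manifold NumberTheorySymbols
open UpperHalfPlane hiding I
open Complex CongruenceSubgroup Function Filter
open Literature.NumberTheory.EllipticCurves.ModularForms
open Literature.NumberTheory.EllipticCurves.Tunnell1983 (thetaMul)

namespace Summit.BirchSwinnertonDyer.BirchSwinnertonDyer.Theorems.PrintCFram.FlipRung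

/-! ## §1 The conjugation `γ₀ T¹⁰²⁴ = N γ₀` and the periodicity of the normalised `P(γ₀•z)` -/

/-- `(Mz + 256)/16 ∈ ℍ` for `M > 0`, `z ∈ ℍ`. [folklore] -/
theorem im_level_mul_add_div_sixteen_pos {M : ℕ} (hM : 0 < M) (z : ℍ) : 0 < (((M : ℂ) * z + 256) / 16).im := by
  rw [show ((M : ℂ) * z + 256) / 16 = ((M : ℂ) * z + 256) / ((16 : ℝ) : ℂ) by norm_num, Complex.div_ofReal_im]
  exact div_pos (im_level_mul_add_256_pos hM z) (by norm_num)

/-- **`γ₀·T¹⁰²⁴ = N·γ₀`** in `SL₂(ℤ)` for `γ₀ = [a b; M 256]` and `N = [1 − 1024aM, 1024a²; −1024M², 1 + 1024aM]` (uses `256a − bM = 1`).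
[folklore] -/
theorem cuspSixteen_mul_T_pow_eq (γ₀ N : SL(2, ℤ)) {M : ℤ} (hM : γ₀ 1 0 = M) (h256 : γ₀ 1 1 = 256)
    (n00 : N 0 0 = 1 - 1024 * γ₀ 0 0 * M) (n01 : N 0 1 = 1024 * γ₀ 0 0 ^ 2) (n10 : N 1 0 = -(1024 * M ^ 2))
    (n11 : N 1 1 = 1 + 1024 * γ₀ 0 0 * M) :
    γ₀ * ModularGroup.T ^ (1024 : ℤ) = N * γ₀ := by
  have hdet : γ₀ 0 0 * 256 - γ₀ 0 1 * M = 1 := by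
    have := Matrix.det_fin_two (γ₀ : Matrix (Fin 2) (Fin 2) ℤ)
    rw [Matrix.SpecialLinearGroup.det_coe, hM, h256] at this
    linear_combination -this
  ext i j
  rw [Matrix.SpecialLinearGroup.coe_mul, Matrix.SpecialLinearGroup.coe_mul, ModularGroup.coe_T_zpow]
  fin_cases i <;> fin_cases j
  · simp [Matrix.mul_apply, Fin.sum_univ_two, hM, n00, n01]; ring
  · simp [Matrix.mul_apply, Fin.sum_univ_two, h256, n00, n01]
    linear_combination (-1024 * γ₀ 0 0) * hdet
  · simp [Matrix.mul_apply, Fin.sum_univ_two, hM, h256, n10, n11]; ring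
  · simp [Matrix.mul_apply, Fin.sum_univ_two, hM, h256, n10, n11]
    linear_combination (-1024 * M) * hdet

/-- **The point identity and the denominator:** `N • (γ₀ • w) = γ₀ • (w + 1024)` and `denom N (γ₀•w) = (M(w+1024)+256)/(Mw+256)`.
[cite: DiamondShurman2005, §1.2] -/
theorem cuspConjSixteen_smul_eq (γ₀ N : SL(2, ℤ)) {M : ℤ} (hM : γ₀ 1 0 = M) (h256 : γ₀ 1 1 = 256)
    (n00 : N 0 0 = 1 - 1024 * γ₀ 0 0 * M) (n01 : N 0 1 = 1024 * γ₀ 0 0 ^ 2) (n10 : N 1 0 = -(1024 * M ^ 2))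
    (n11 : N 1 1 = 1 + 1024 * γ₀ 0 0 * M) (w : ℍ) :
    N • (γ₀ • w) = γ₀ • ((1024 : ℝ) +ᵥ w) ∧
    denom N ((γ₀ • w : ℍ)) = ((M : ℂ) * ((((1024 : ℝ) +ᵥ w : ℍ)) : ℂ) + 256) / ((M : ℂ) * w + 256) := by
  have hdet : γ₀ 0 0 * 256 - γ₀ 0 1 * M = 1 := by
    have := Matrix.det_fin_two (γ₀ : Matrix (Fin 2) (Fin 2) ℤ)
    rw [Matrix.SpecialLinearGroup.det_coe, hM, h256] at this
    linear_combination -this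
  have hmat := cuspSixteen_mul_T_pow_eq γ₀ N hM h256 n00 n01 n10 n11
  have hsmul : N • (γ₀ • w) = γ₀ • ((1024 : ℝ) +ᵥ w) := by
    rw [← mul_smul, ← hmat, mul_smul, UpperHalfPlane.modular_T_zpow_smul]
    norm_num
  refine ⟨hsmul, ?_⟩
  -- the denominator, as a complex-number computation
  have hden0 : denom γ₀ w = (M : ℂ) * w + 256 := by rw [ModularGroup.denom_apply, hM, h256]; push_cast; ring
  have hw : (M : ℂ) * w + 256 ≠ 0 := by rw [← hden0]; exact denom_ne_zero γ₀ w
  have hdetC : (γ₀ 0 0 : ℂ) * 256 - (γ₀ 0 1 : ℂ) * M = 1 := by exact_mod_cast hdet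
  have hγw : ((γ₀ • w : ℍ) : ℂ) = ((γ₀ 0 0 : ℂ) * w + (γ₀ 0 1 : ℂ)) / ((M : ℂ) * w + 256) := by
    rw [coe_specialLinearGroup_apply, hM, h256]
    simp only [eq_intCast, Int.cast_ofNat]
    push_cast
    ring
  rw [ModularGroup.denom_apply, n10, n11, hγw, coe_vadd]
  push_cast
  rw [eq_div_iff hw]
  field_simp
  linear_combination (1024 * (M : ℂ)) * hdetC

/-- **The automorphy factor of `N` at `γ₀•w` is the ratio of P6a/P6c's bases:** for any `ψ` with `N_P ∣ 1024M`:
`autFactor κ N_P ψ N (γ₀•w) = √((M(w+1024)+256)/(Mw+256))^κ` — `ε_d = 1` and `(−1024M²/d) = 1` by P6d's lemmas at `(M″, u) = (4M, 32a)`.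
[cite: Shimura1973HalfIntegral, §1] -/
theorem autFactor_cuspConjSixteen_eq {κ NP : ℕ} (ψ : DirichletCharacter ℂ NP) (γ₀ N : SL(2, ℤ)) {M : ℤ} (hM : γ₀ 1 0 = M)
    (h256 : γ₀ 1 1 = 256) (hM0 : M ≠ 0)
    (n00 : N 0 0 = 1 - 1024 * γ₀ 0 0 * M) (n01 : N 0 1 = 1024 * γ₀ 0 0 ^ 2) (n10 : N 1 0 = -(1024 * M ^ 2))
    (n11 : N 1 1 = 1 + 1024 * γ₀ 0 0 * M) (hNP : (NP : ℤ) ∣ 1024 * M) (w : ℍ) :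
    autFactor κ NP ψ N (γ₀ • w) =
      Complex.sqrt (((M : ℂ) * ((w : ℂ) + 1024) + 256) / ((M : ℂ) * w + 256)) ^ κ := by
  obtain ⟨-, hden⟩ := cuspConjSixteen_smul_eq γ₀ N hM h256 n00 n01 n10 n11 w
  have hψ : ψ ((N 1 1 : ℤ) : ZMod NP) = 1 := by
    rw [n11]
    have hd : (NP : ℤ) ∣ 1024 * γ₀ 0 0 * M := by
      obtain ⟨c, hc⟩ := hNP; exact ⟨c * γ₀ 0 0, by linear_combination γ₀ 0 0 * hc⟩
    have h1 : (((1 + 1024 * γ₀ 0 0 * M : ℤ)) : ZMod NP) = 1 := by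
      rw [Int.cast_add, Int.cast_one, (ZMod.intCast_zmod_eq_zero_iff_dvd _ NP).mpr hd, add_zero]
    rw [h1, map_one]
  have hθ : thetaFactor (N 1 0) (N 1 1) (γ₀ • w) = Complex.sqrt (((M : ℂ) * ((w : ℂ) + 1024) + 256) / ((M : ℂ) * w + 256)) := by
    unfold thetaFactor
    have hcd : ((N 1 0 : ℤ) : ℂ) * ((γ₀ • w : ℍ) : ℂ) + ((N 1 1 : ℤ) : ℂ) =
        ((M : ℂ) * ((w : ℂ) + 1024) + 256) / ((M : ℂ) * w + 256) := by
      rw [← ModularGroup.denom_apply, hden, coe_vadd]; push_cast; ring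
    have hε : thetaEps (N 1 1) = 1 := by
      rw [n11, show (1 + 1024 * γ₀ 0 0 * M : ℤ) = 1 + 8 * (4 * M) * (32 * γ₀ 0 0) by ring]
      exact thetaEps_one_add_eight_mul _ _
    have hσ : shimuraSymbol (N 1 0) (N 1 1) = 1 := by
      rw [n10, n11, show (-(1024 * M ^ 2) : ℤ) = -(64 * (4 * M) ^ 2) by ring,
        show (1 + 1024 * γ₀ 0 0 * M : ℤ) = 1 + 8 * (4 * M) * (32 * γ₀ 0 0) by ring]
      exact shimuraSymbol_neg_sq_one_add_eight_mul (by omega) _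
    rw [hcd, hε, hσ]
    simp
  rw [autFactor, hψ, hθ, one_mul]

/-- **THE NORMALISED `P(γ₀•z)` IS `1024`-PERIODIC** for `P ∈ halfIntModularForms κ N_P ψ` with `4 ∣ N_P`, `N_P ∣ 1024M` (`M ≠ 0`), and any
admissible base pair `X, Y` in the upper half-plane with `Y/X = (M(w+1024)+256)/(Mw+256)`:
`P(γ₀•(w+1024))·(√Y^κ)⁻¹ = P(γ₀•w)·(√X^κ)⁻¹`. [cite: Shimura1973HalfIntegral, §1] -/
theorem cuspTranslateSixteen_periodic_of_ratio {κ NP : ℕ} {ψ : DirichletCharacter ℂ NP} (h4 : 4 ∣ NP) {P : ℍ → ℂ}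
    (hP : P ∈ halfIntModularForms κ NP ψ) (γ₀ : SL(2, ℤ)) {M : ℤ} (hM : γ₀ 1 0 = M) (h256 : γ₀ 1 1 = 256)
    (hM0 : M ≠ 0) (hNP : (NP : ℤ) ∣ 1024 * M) (w : ℍ)
    {X Y : ℂ} (hX : 0 < X.im) (hY : 0 < Y.im) (hXY : Y / X = ((M : ℂ) * ((w : ℂ) + 1024) + 256) / ((M : ℂ) * w + 256)) :
    P (γ₀ • ((1024 : ℝ) +ᵥ w)) * (Complex.sqrt Y ^ κ)⁻¹ = P (γ₀ • w) * (Complex.sqrt X ^ κ)⁻¹ := by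
  let N : SL(2, ℤ) := ⟨!![1 - 1024 * γ₀ 0 0 * M, 1024 * γ₀ 0 0 ^ 2; -(1024 * M ^ 2), 1 + 1024 * γ₀ 0 0 * M], by
    rw [Matrix.det_fin_two_of]; ring⟩
  have n00 : N 0 0 = 1 - 1024 * γ₀ 0 0 * M := rfl
  have n01 : N 0 1 = 1024 * γ₀ 0 0 ^ 2 := rfl
  have n10 : N 1 0 = -(1024 * M ^ 2) := rfl
  have n11 : N 1 1 = 1 + 1024 * γ₀ 0 0 * M := rfl
  obtain ⟨hsmul, -⟩ := cuspConjSixteen_smul_eq γ₀ N hM h256 n00 n01 n10 n11 w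
  have hmem : N ∈ Gamma0 NP := by
    rw [Gamma0_mem, n10, ZMod.intCast_zmod_eq_zero_iff_dvd]
    obtain ⟨c, hc⟩ := hNP
    exact ⟨-(c * M), by linear_combination (-M) * hc⟩
  have haut := apply_smul_eq_of_mem (k := κ) (χ := ψ) h4 hP hmem (γ₀ • w)
  rw [hsmul, autFactor_cuspConjSixteen_eq ψ γ₀ N hM h256 hM0 n00 n01 n10 n11 hNP w, ← hXY, csqrt_div_eq_of_im_pos hX hY,
    div_pow] at haut
  have hsX : Complex.sqrt X ^ κ ≠ 0 := by
    refine pow_ne_zero κ fun h0 ↦ ?_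
    have : X = 0 := by rw [← csqrt_sq X, h0]; ring
    rw [this] at hX; simp at hX
  have hsY : Complex.sqrt Y ^ κ ≠ 0 := by
    refine pow_ne_zero κ fun h0 ↦ ?_
    have : Y = 0 := by rw [← csqrt_sq Y, h0]; ring
    rw [this] at hY; simp at hY
  rw [haut]
  field_simp

/-- **`bracketSixteen_periodic`: THE BRACKET IS `1024`-PERIODIC.** With `B₁₆(z) = 16^{−(k+1)}·P(γ₀•z)·(√((Mz+256)/16)^{2k+1})⁻¹` (`M > 0`,
`P ∈ halfIntModularForms (2k+1) N_P ψ`, `4 ∣ N_P`, `N_P ∣ 1024M`): `B₁₆(z + 1024) = B₁₆(z)`. [cite: Shimura1973HalfIntegral, §1] -/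
theorem bracketSixteen_periodic {k NP : ℕ} {ψ : DirichletCharacter ℂ NP} (h4 : 4 ∣ NP) {P : ℍ → ℂ}
    (hP : P ∈ halfIntModularForms (2 * k + 1) NP ψ) (γ₀ : SL(2, ℤ)) {M : ℕ} (hM : (γ₀ 1 0 : ℤ) = M) (h256 : (γ₀ 1 1 : ℤ) = 256)
    (hMpos : 0 < M) (hNP : (NP : ℤ) ∣ 1024 * (M : ℤ)) (z : ℍ) :
    ((16 : ℂ)⁻¹) ^ (k + 1) * (P (γ₀ • ((1024 : ℝ) +ᵥ z)) *
        (Complex.sqrt (((M : ℂ) * ((((1024 : ℝ) +ᵥ z : ℍ)) : ℂ) + 256) / 16) ^ (2 * k + 1))⁻¹) =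
      ((16 : ℂ)⁻¹) ^ (k + 1) * (P (γ₀ • z) * (Complex.sqrt (((M : ℂ) * z + 256) / 16) ^ (2 * k + 1))⁻¹) := by
  congr 1
  have hX : 0 < (((M : ℂ) * z + 256) / 16).im := im_level_mul_add_div_sixteen_pos hMpos z
  have h1024 : ((((1024 : ℝ) +ᵥ z : ℍ)) : ℂ) = (z : ℂ) + 1024 := by rw [coe_vadd]; push_cast; ring
  have hY : 0 < (((M : ℂ) * ((z : ℂ) + 1024) + 256) / 16).im := by
    rw [show ((M : ℂ) * ((z : ℂ) + 1024) + 256) / 16 = ((M : ℂ) * ((z : ℂ) + 1024) + 256) / ((16 : ℝ) : ℂ) by norm_num,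
      Complex.div_ofReal_im]
    have : ((M : ℂ) * ((z : ℂ) + 1024) + 256).im = (M : ℝ) * z.im := by simp
    rw [this]; exact div_pos (mul_pos (by exact_mod_cast hMpos) z.im_pos) (by norm_num)
  rw [h1024]
  refine cuspTranslateSixteen_periodic_of_ratio h4 hP γ₀ (M := (M : ℤ)) hM h256 (by exact_mod_cast hMpos.ne') hNP z hX hY ?_
  have hX0 : ((M : ℂ) * z + 256) ≠ 0 := by
    intro h0; have := im_level_mul_add_256_pos hMpos z; rw [h0] at this; simp at this
  push_cast
  field_simp

/-- The bracket composed with `ofComplex` is `N`-periodic for `1024 ∣ N`. [folklore] -/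
theorem bracketSixteen_periodic_comp_ofComplex {k NP : ℕ} {ψ : DirichletCharacter ℂ NP} (h4 : 4 ∣ NP) {P : ℍ → ℂ}
    (hP : P ∈ halfIntModularForms (2 * k + 1) NP ψ) (γ₀ : SL(2, ℤ)) {M : ℕ} (hM : (γ₀ 1 0 : ℤ) = M) (h256 : (γ₀ 1 1 : ℤ) = 256)
    (hMpos : 0 < M) (hNP : (NP : ℤ) ∣ 1024 * (M : ℤ)) {N : ℕ} (hN : 1024 ∣ N) :
    Periodic ((fun z : ℍ ↦ ((16 : ℂ)⁻¹) ^ (k + 1) * (P (γ₀ • z) *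
      (Complex.sqrt (((M : ℂ) * z + 256) / 16) ^ (2 * k + 1))⁻¹)) ∘ ofComplex) (N : ℝ) := by
  have h1 : Periodic ((fun z : ℍ ↦ ((16 : ℂ)⁻¹) ^ (k + 1) * (P (γ₀ • z) *
      (Complex.sqrt (((M : ℂ) * z + 256) / 16) ^ (2 * k + 1))⁻¹)) ∘ ofComplex) (1024 : ℝ) := by
    intro w
    by_cases hw : 0 < w.im
    · have h1w : 0 < (w + (1024 : ℝ)).im := by simpa using hw
      simp only [Function.comp_apply]
      rw [ofComplex_apply_of_im_pos h1w, ofComplex_apply_of_im_pos hw]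
      have e : (⟨w + (1024 : ℝ), h1w⟩ : ℍ) = (1024 : ℝ) +ᵥ ⟨w, hw⟩ := by
        ext; simp [coe_vadd, add_comm]
      rw [e]
      exact bracketSixteen_periodic h4 hP γ₀ hM h256 hMpos hNP ⟨w, hw⟩
    · simp only [Function.comp_apply]
      rw [ofComplex_apply_eq_of_im_nonpos (by simpa using not_lt.mp hw) (not_lt.mp hw)]
  obtain ⟨n, rfl⟩ := hN
  have h := h1.nat_mul n
  have e : ((((1024 * n : ℕ)) : ℝ) : ℂ) = (n : ℂ) * ((1024 : ℝ) : ℂ) := by push_cast; ring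
  rw [e]
  exact h

/-! ## §2 `B₁₆` is holomorphic and bounded at `i∞` -/

/-- **`B₁₆` is holomorphic** (`P` holomorphic, the Möbius action, and P6e's `√((Mz+256)/16) = j(·;M,256)/√16`, `M` odd). [folklore] -/
theorem mdifferentiable_bracketSixteen {k NP : ℕ} {ψ : DirichletCharacter ℂ NP} {P : ℍ → ℂ}
    (hP : P ∈ halfIntModularForms (2 * k + 1) NP ψ) (γ₀ : SL(2, ℤ)) {M : ℕ} (hModd : Odd M) :
    MDifferentiable 𝓘(ℂ) 𝓘(ℂ) (fun z : ℍ ↦ ((16 : ℂ)⁻¹) ^ (k + 1) * (P (γ₀ • z) *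
      (Complex.sqrt (((M : ℂ) * z + 256) / 16) ^ (2 * k + 1))⁻¹)) := by
  have h1 := mdifferentiable_comp_smul hP.1 γ₀
  have hgcd : Int.gcd M 256 = 1 := by
    obtain ⟨m, hm⟩ := hModd
    have hc : IsCoprime (M : ℤ) (2 ^ 8) := IsCoprime.pow_right ⟨1, -(m : ℤ), by rw [hm]; push_cast; ring⟩
    have := Int.isCoprime_iff_gcd_eq_one.mp hc
    norm_num at this
    exact this
  have h2 : MDifferentiable 𝓘(ℂ) 𝓘(ℂ) (fun z : ℍ ↦ (Complex.sqrt (((M : ℂ) * z + 256) / 16) ^ (2 * k + 1))⁻¹) := by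
    have e : (fun z : ℍ ↦ (Complex.sqrt (((M : ℂ) * z + 256) / 16) ^ (2 * k + 1))⁻¹) =
        fun z : ℍ ↦ ((thetaFactor M 256 z) ^ (2 * k + 1))⁻¹ * ((Real.sqrt 16 : ℝ) : ℂ) ^ (2 * k + 1) := by
      funext z
      rw [csqrt_level_div_sixteen_eq_thetaFactor hModd, mul_pow, mul_inv, inv_pow _ (2 * k + 1), inv_inv]
    rw [e]
    refine MDifferentiable.mul ?_ mdifferentiable_const
    have hθ := (mdifferentiable_thetaFactor (M : ℤ) 256).pow (2 * k + 1)
    rw [UpperHalfPlane.mdifferentiable_iff] at hθ ⊢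
    refine (hθ.inv fun w hw ↦ ?_).congr fun w hw ↦ by simp [Function.comp_apply]
    simp only [Function.comp_apply]
    exact pow_ne_zero _ (thetaFactor_ne_zero hgcd _)
  exact mdifferentiable_const.mul (h1.mul h2)

/-- **`B₁₆` is bounded at `i∞`:** `‖B₁₆(z)‖² = 16⁻¹·‖slashSq (2k+1) P γ₀ z‖`, and `P ∈ M_{(2k+1)/2}` satisfies the cusp condition at `γ₀`.
[folklore] -/
theorem isBoundedAtImInfty_bracketSixteen {k NP : ℕ} {ψ : DirichletCharacter ℂ NP} {P : ℍ → ℂ}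
    (hP : P ∈ halfIntModularForms (2 * k + 1) NP ψ) (γ₀ : SL(2, ℤ)) {M : ℕ} (hM : (γ₀ 1 0 : ℤ) = M) (h256 : (γ₀ 1 1 : ℤ) = 256) :
    IsBoundedAtImInfty (fun z : ℍ ↦ ((16 : ℂ)⁻¹) ^ (k + 1) * (P (γ₀ • z) *
      (Complex.sqrt (((M : ℂ) * z + 256) / 16) ^ (2 * k + 1))⁻¹)) := by
  have h := hP.2.2 γ₀
  rw [isBoundedAtImInfty_iff] at h ⊢
  obtain ⟨B, A, hB⟩ := h
  refine ⟨Real.sqrt (16⁻¹ * B), A, fun z hz ↦ ?_⟩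
  have hden : denom γ₀ z = (M : ℂ) * z + 256 := by rw [ModularGroup.denom_apply, hM, h256]; push_cast; ring
  have hX0 : (M : ℂ) * z + 256 ≠ 0 := by rw [← hden]; exact denom_ne_zero γ₀ z
  have hslash : ‖slashSq (2 * k + 1) P γ₀ z‖ = ‖P (γ₀ • z)‖ ^ 2 / ‖(M : ℂ) * z + 256‖ ^ (2 * k + 1) := by
    rw [norm_slashSq, hden]
  have hsqC : (((16 : ℂ)⁻¹) ^ (k + 1) * (P (γ₀ • z) * (Complex.sqrt (((M : ℂ) * z + 256) / 16) ^ (2 * k + 1))⁻¹)) ^ 2 =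
      (16 : ℂ)⁻¹ * slashSq (2 * k + 1) P γ₀ z := by
    have hs2 : (Complex.sqrt (((M : ℂ) * z + 256) / 16) ^ (2 * k + 1)) ^ 2 =
        ((M : ℂ) * z + 256) ^ (2 * k + 1) / 16 ^ (2 * k + 1) := by
      rw [← pow_mul, pow_mul', csqrt_sq, div_pow]
    simp only [slashSq, mul_pow, inv_pow]
    rw [hden, hs2]
    have h16 : (16 : ℂ) ^ (2 * k + 1) ≠ 0 := pow_ne_zero _ (by norm_num)
    have hXk : ((M : ℂ) * z + 256) ^ (2 * k + 1) ≠ 0 := pow_ne_zero _ hX0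
    field_simp
    ring
  have hsq : ‖((16 : ℂ)⁻¹) ^ (k + 1) * (P (γ₀ • z) * (Complex.sqrt (((M : ℂ) * z + 256) / 16) ^ (2 * k + 1))⁻¹)‖ ^ 2 =
      16⁻¹ * ‖slashSq (2 * k + 1) P γ₀ z‖ := by
    rw [← norm_pow, hsqC, norm_mul, norm_inv]
    norm_num
  have hle : ‖((16 : ℂ)⁻¹) ^ (k + 1) * (P (γ₀ • z) * (Complex.sqrt (((M : ℂ) * z + 256) / 16) ^ (2 * k + 1))⁻¹)‖ ^ 2 ≤
      16⁻¹ * B := by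
    rw [hsq]; exact mul_le_mul_of_nonneg_left (hB z hz) (by norm_num)
  calc ‖((16 : ℂ)⁻¹) ^ (k + 1) * (P (γ₀ • z) * (Complex.sqrt (((M : ℂ) * z + 256) / 16) ^ (2 * k + 1))⁻¹)‖
      = Real.sqrt (‖((16 : ℂ)⁻¹) ^ (k + 1) * (P (γ₀ • z) *
          (Complex.sqrt (((M : ℂ) * z + 256) / 16) ^ (2 * k + 1))⁻¹)‖ ^ 2) := (Real.sqrt_sq (norm_nonneg _)).symm
    _ ≤ Real.sqrt (16⁻¹ * B) := Real.sqrt_le_sqrt hle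

/-- `B₁₆` has an analytic cusp function at period `N` (`1024 ∣ N`, `N ≥ 1`) and Mathlib's `HasSum` of its `qExpansion N`.
[cite: DiamondShurman2005, §1.1] -/
theorem bracketSixteen_analytic_and_hasSum {k NP : ℕ} {ψ : DirichletCharacter ℂ NP} (h4 : 4 ∣ NP) {P : ℍ → ℂ}
    (hP : P ∈ halfIntModularForms (2 * k + 1) NP ψ) (γ₀ : SL(2, ℤ)) {M : ℕ} (hM : (γ₀ 1 0 : ℤ) = M) (h256 : (γ₀ 1 1 : ℤ) = 256)
    (hModd : Odd M) (hNP : (NP : ℤ) ∣ 1024 * (M : ℤ)) {N : ℕ} (hN : 1024 ∣ N) (hN0 : 0 < N) :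
    AnalyticAt ℂ (cuspFunction N (fun z : ℍ ↦ ((16 : ℂ)⁻¹) ^ (k + 1) * (P (γ₀ • z) *
      (Complex.sqrt (((M : ℂ) * z + 256) / 16) ^ (2 * k + 1))⁻¹))) 0 ∧
    ∀ τ : ℍ, HasSum (fun m : ℕ ↦ (qExpansion N (fun z : ℍ ↦ ((16 : ℂ)⁻¹) ^ (k + 1) * (P (γ₀ • z) *
      (Complex.sqrt (((M : ℂ) * z + 256) / 16) ^ (2 * k + 1))⁻¹))).coeff m • Periodic.qParam N (τ : ℂ) ^ m)
      (((16 : ℂ)⁻¹) ^ (k + 1) * (P (γ₀ • τ) * (Complex.sqrt (((M : ℂ) * τ + 256) / 16) ^ (2 * k + 1))⁻¹)) := by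
  have hper := bracketSixteen_periodic_comp_ofComplex h4 hP γ₀ hM h256 hModd.pos hNP hN
  have hhol := mdifferentiable_bracketSixteen hP γ₀ hModd (k := k)
  have hbdd := isBoundedAtImInfty_bracketSixteen hP γ₀ hM h256 (k := k)
  have hNR : (0 : ℝ) < N := by exact_mod_cast hN0
  exact ⟨UpperHalfPlane.analyticAt_cuspFunction_zero hNR hper hhol hbdd,
    fun τ ↦ UpperHalfPlane.hasSum_qExpansion hNR hper hhol hbdd τ⟩

/-! ## §3 The transport -/

/-- **P6f — THE NF-Q TRANSPORT AT THE `e = 3` FLIPPED CUSP `W₁₆`, THROUGH A FACTORISATION.** NF-Q (Katz 1973 Cor. 1.6.2, hypothesis);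
`γ₀ = [a b; M 256] ∈ SL₂(ℤ)`, `M` odd; `f : ModularForm (Gamma1 L) (k+1)` (the `e = 3` Katz vehicle `P·θ(16·)`), `L ∣ N`, `3 ≤ N`, `1024 ∣ N`,
`P ∈ halfIntModularForms (2k+1) N_P ψ` with `4 ∣ N_P ∣ 1024M`, EVERY coefficient of `qExpansion 1 f` in `p·ℤ̄[1/N]` (the class hypothesis
at `∞`), and a factorisation `f ∣_{k+1} γ₀ = Θ · B₁₆` with `B₁₆(z) = 16^{−(k+1)}·P(γ₀•z)·(√((Mz+256)/16)^{2k+1})⁻¹` and `Θ` having an analytic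
cusp function at period `N`, coefficients in `ℤ̄[1/N]` and a unit constant term (for `Θ = θ(16·(γ₀•z))·(√((Mz+256)/16))⁻¹` these are
the P6e lemmas). Then EVERY coefficient of `qExpansion N B₁₆` lies in `p·ℤ̄[1/N]` (§2 + w3 g19's
`exists_isIntegral_qExpansion_coeff_of_slash_eq_mul`). CONDITIONAL on NF-Q (hypothesis). [cite: Katz1973, §1.6 Cor. 1.6.2]
[cite: Shimura1973HalfIntegral, §1] -/
theorem exists_isIntegral_bracketSixteen_coeff_of_factorisation
    (hKatz : Literature.NumberTheory.ModularForms.Katz1973_qExpansionPrinciple_allCusps)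
    {k M : ℕ} (hModd : Odd M) (γ₀ : SL(2, ℤ)) (hM : (γ₀ 1 0 : ℤ) = M) (h256 : (γ₀ 1 1 : ℤ) = 256)
    {L N : ℕ} (hLN : L ∣ N) (hN3 : 3 ≤ N) (h1024 : 1024 ∣ N)
    (f : ModularForm (Gamma1 L) ((k + 1 : ℕ) : ℤ))
    {NP : ℕ} {ψ : DirichletCharacter ℂ NP} (h4 : 4 ∣ NP) {P : ℍ → ℂ} (hP : P ∈ halfIntModularForms (2 * k + 1) NP ψ)
    (hNP : (NP : ℤ) ∣ 1024 * (M : ℤ)) (p : ℕ)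
    (hcoef : ∀ n : ℕ, ∃ y : ℂ, (∃ j : ℕ, IsIntegral ℤ ((N : ℂ) ^ j * y)) ∧ (qExpansion 1 ⇑f).coeff n = (p : ℂ) * y)
    {Θ : ℍ → ℂ}
    (hfac : ∀ z : ℍ, (⇑f ∣[((k + 1 : ℕ) : ℤ)] γ₀) z =
      Θ z * (((16 : ℂ)⁻¹) ^ (k + 1) * (P (γ₀ • z) * (Complex.sqrt (((M : ℂ) * z + 256) / 16) ^ (2 * k + 1))⁻¹)))
    (hΘ : AnalyticAt ℂ (cuspFunction N Θ) 0)
    (hΘint : ∀ n : ℕ, ∃ j : ℕ, IsIntegral ℤ ((N : ℂ) ^ j * (qExpansion N Θ).coeff n))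
    (hΘ0 : ∃ v : ℂ, (∃ j : ℕ, IsIntegral ℤ ((N : ℂ) ^ j * v)) ∧ (qExpansion N Θ).coeff 0 * v = 1)
    (n : ℕ) :
    ∃ y : ℂ, (∃ j : ℕ, IsIntegral ℤ ((N : ℂ) ^ j * y)) ∧
      (qExpansion N (fun z : ℍ ↦ ((16 : ℂ)⁻¹) ^ (k + 1) * (P (γ₀ • z) *
        (Complex.sqrt (((M : ℂ) * z + 256) / 16) ^ (2 * k + 1))⁻¹))).coeff n = (p : ℂ) * y := by
  have hN0 : 0 < N := by omega
  obtain ⟨hB, -⟩ := bracketSixteen_analytic_and_hasSum h4 hP γ₀ hM h256 hModd hNP h1024 hN0 (k := k)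
  exact exists_isIntegral_qExpansion_coeff_of_slash_eq_mul hKatz hLN hN3 f p hcoef γ₀ hfac hΘ hB hΘint hΘ0 n

/-- `2M ∣ N` from `M ∣ N`, `2 ∣ N` and `M` odd. [folklore] -/
theorem two_mul_dvd_of_odd {M N : ℕ} (hModd : Odd M) (hMN : M ∣ N) (h2N : 2 ∣ N) : 2 * M ∣ N := by
  have hcop : Nat.Coprime 2 M := (Nat.Prime.coprime_iff_not_dvd Nat.prime_two).mpr (by obtain ⟨m, hm⟩ := hModd; omega)
  exact hcop.mul_dvd_of_dvd_of_dvd h2N hMN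

/-- **P6f — THE NF-Q TRANSPORT AT THE `e = 3` FLIPPED CUSP `W₁₆` (product vehicle `f = P·θ(16·)`, all Θ-inputs discharged).** NF-Q
(Katz 1973 Cor. 1.6.2, hypothesis); `γ₀ = [a b; M 256] ∈ SL₂(ℤ)`, `M` odd; `f : ModularForm (Gamma1 L) (k+1)` whose function is the `e = 3` Katz
vehicle `P·θ(16·)` (`P ∈ halfIntModularForms (2k+1) N_P ψ`, `4 ∣ N_P ∣ 1024M` — the modulus-`16` even-class cut of `g` at level `4M`
qualifies, w5 g9's vehicle file), `L ∣ N`, `3 ≤ N`, `1024 ∣ N`, `M ∣ N`, and EVERY coefficient of `qExpansion 1 f` in `p·ℤ̄[1/N]` (the class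
hypothesis at `∞`). Then EVERY coefficient of `qExpansion N B₁₆`, `B₁₆(z) = 16^{−(k+1)}·P(γ₀•z)·(√((Mz+256)/16)^{2k+1})⁻¹` — P6a/P6c's
bracket — lies in `p·ℤ̄[1/N]`: w8 g10's P6e factorisation `slash_flippedCusp_eq_thetaSixteen_mul_bracket` and Θ-hypotheses
`thetaSixteen_transport_hypotheses`, §2's `B₁₆`-analyticity, and w3 g19's `exists_isIntegral_qExpansion_coeff_of_slash_eq_mul`. The `R = 16`
twin of w5 g8's `exists_isIntegral_bracket_coeff`. CONDITIONAL on NF-Q (hypothesis). [cite: Katz1973, §1.6 Cor. 1.6.2]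
[cite: Shimura1973HalfIntegral, §1] -/
theorem exists_isIntegral_bracketSixteen_coeff
    (hKatz : Literature.NumberTheory.ModularForms.Katz1973_qExpansionPrinciple_allCusps)
    {k M : ℕ} [NeZero M] (hModd : Odd M) (γ₀ : SL(2, ℤ)) (hM : (γ₀ 1 0 : ℤ) = M) (h256 : (γ₀ 1 1 : ℤ) = 256)
    {L N : ℕ} (hLN : L ∣ N) (hN3 : 3 ≤ N) (h1024 : 1024 ∣ N) (hMN : M ∣ N)
    (f : ModularForm (Gamma1 L) ((k + 1 : ℕ) : ℤ)) {P : ℍ → ℂ} (hf : ∀ z : ℍ, f z = P z * thetaMul 16 z)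
    {NP : ℕ} {ψ : DirichletCharacter ℂ NP} (h4 : 4 ∣ NP) (hP : P ∈ halfIntModularForms (2 * k + 1) NP ψ)
    (hNP : (NP : ℤ) ∣ 1024 * (M : ℤ)) (p : ℕ)
    (hcoef : ∀ n : ℕ, ∃ y : ℂ, (∃ j : ℕ, IsIntegral ℤ ((N : ℂ) ^ j * y)) ∧ (qExpansion 1 ⇑f).coeff n = (p : ℂ) * y)
    (n : ℕ) :
    ∃ y : ℂ, (∃ j : ℕ, IsIntegral ℤ ((N : ℂ) ^ j * y)) ∧
      (qExpansion N (fun z : ℍ ↦ ((16 : ℂ)⁻¹) ^ (k + 1) * (P (γ₀ • z) *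
        (Complex.sqrt (((M : ℂ) * z + 256) / 16) ^ (2 * k + 1))⁻¹))).coeff n = (p : ℂ) * y := by
  have hN0 : 0 < N := by omega
  have h64 : 64 ∣ N := (show (64 : ℕ) ∣ 1024 by norm_num).trans h1024
  have h2MN : 2 * M ∣ N := two_mul_dvd_of_odd hModd hMN ((show (2 : ℕ) ∣ 1024 by norm_num).trans h1024)
  obtain ⟨hΘ, hΘint, hΘ0⟩ := thetaSixteen_transport_hypotheses γ₀ (a := γ₀ 0 0) (b := γ₀ 0 1) rfl rfl hM h256 hModd h64 hN0 h2MN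
  exact exists_isIntegral_bracketSixteen_coeff_of_factorisation hKatz hModd γ₀ hM h256 hLN hN3 h1024 f h4 hP hNP p hcoef
    (fun z ↦ slash_flippedCusp_eq_thetaSixteen_mul_bracket γ₀ hM h256 k hf z) hΘ hΘint hΘ0 n

end Summit.BirchSwinnertonDyer.BirchSwinnertonDyer.Theorems.PrintCFram.FlipRung

end
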